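import Summits.ResolutionOfSingularities.ResolutionOfSingularities.Theorems.FrobeniusLadderFInjectiveMacaulayficationPencilExitTagCode1
import HarnessLib

/-!
# TASK 4b SOUNDNESS ENGINE: the coefficient of `W^j·y^d` in the reduced Fedder element of a pencil chart, the unitriangular reduction `w₀ ≠ 0 ↦ w₀ = 0`, and the
# substitution wrapper (crux `FInjectiveMacaulayfication` stmt-ResolutionOfSingularities-15315, chain w45a; RULING R23.8 (3) / plan-1 ACK l.85626 «stub-1 g15 → remaining exit
# codes»; consumer res-L1-w45a-stub-3 TASK 4c; seat res-L1-w45a-stub-1 g15)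

[OURS · L1 W4.5a] Support file (`--supports stmt-ResolutionOfSingularities-15315 --as helper`); theorems only; unconditional; any field of characteristic `p`. Nothing of the crux is
proved; no census row is asserted. AI-written (AI review is weaker than expert review).

WHAT THIS FILE ABSTRACTS from ✓p696297 / ✓p696956 / ✓p697883 (codes 2/4, 1). Every pencil-chart equation has the shape `Φ = A⁺·X 0 − B⁺` (`q⁺ = rename Fin.succ q`, `A, B ∈ k[y₁..y_n]`;
`W`-chart: `A = y^{M₁}`, `B = y^{M₂}(y^r − y^s)`; `U`-chart: `A = y^{M₂}(y^r − y^s)`, `B = y^{M₁}`). At a closed point `(w₀; c)` a substitution `θ` with `W ↦ W + w₀` and each base letter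
`y_i ↦ c_i` (killed to its value) or `y_i ↦ y_i + c_i` (kept as a test variable, `i ∈ T₀`) sends `Φ` to `A′⁺·X 0 + Γ′⁺`, `A′ = θᵥA`, `Γ′ = w₀·A′ − θᵥB`, and
`coeff_{W^j y^d} (A′⁺X 0 + Γ′⁺)^N = C(N, j)·coeff_d (A′^j Γ′^{N−j})` (§1). When `A′ = y^a·u` and the target exponent `d` is below `(j+1)·a` at one letter, the `w₀`-terms of
`Γ′^{N−j} = (w₀A′ − B′)^{N−j}` do not reach `d`: `coeff_d (A′^j Γ′^{N−j}) = coeff_d (A′^j (−B′)^{N−j})` (§2, the «unitriangularity» of the tags of ✓p694236 — this is what makes a tag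
valid at EVERY point `w₀` of the fibre line, not only at `w₀ = 0`). §3: `C(N, j) ≠ 0` in characteristic `p > N`. §4: the two coefficient computations the codes need (pencil codes:
constant terms are multiplicative; deep codes: one monomial of a binomial power). §5 ★★ `fullCl_linearChart_of_subst` = §1 + §3 + ✓p695452 `hypersurface_fullCl_stalk_of_reduction`: FULL
at `(w₀; c)` from ONE non-zero coefficient `coeff_d (A′^j Γ′^{N−j})`, `j < p`, `d|_{T₀} < p`; ★★ `fullCl_linearChart_pole_of_subst` (the point `w₀ = 0`, no shift, `Γ′ = −B′`).
[cite: Fedder1983, Thm. 1.12]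
-/

set_option linter.dupNamespace false

noncomputable section

open AlgebraicGeometry IsLocalRing MvPolynomial
open scoped Pointwise

namespace Summit.ResolutionOfSingularities.ResolutionOfSingularities.Theorems.FInjectiveMacaulayfication.PencilExitWitness

open Summit.ResolutionOfSingularities.ResolutionOfSingularities.Theorems.FInjectiveMacaulayfication
open SliceableCentre

variable (k : Type) [Field k] {n : ℕ}

/-! ## §1 The `W^j`-layer of `(A⁺·X 0 + Γ⁺)^N` -/

/-- **The coefficient of `W^j·y^d` in `(A⁺·W + Γ⁺)^N` is `C(N, j)·coeff_d(A^j·Γ^{N−j})`** (`W = X 0`, `q⁺ = rename Fin.succ q`). [plumbing; binomial theorem in `k[y][W]`] -/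
theorem coeff_cons_linear_pow (A Γ : MvPolynomial (Fin n) k) (N j : ℕ) (hj : j ≤ N) (d : Fin n →₀ ℕ) :
    coeff (Finsupp.cons j d) ((rename Fin.succ A * X 0 + rename Fin.succ Γ) ^ N) = ((N.choose j : ℕ) : k) * coeff d (A ^ j * Γ ^ (N - j)) := by
  rw [← finSuccEquiv_coeff_coeff, map_pow, map_add, map_mul, PencilIntegral.finSuccEquiv_rename_succ, PencilIntegral.finSuccEquiv_rename_succ,
    finSuccEquiv_X_zero, add_pow, Polynomial.finsetSum_coeff]
  have hterm : ∀ m ∈ Finset.range (N + 1), ((Polynomial.C A * Polynomial.X) ^ m * Polynomial.C Γ ^ (N - m) * ((N.choose m : ℕ) : Polynomial (MvPolynomial (Fin n) k))).coeff j =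
      if j = m then A ^ m * Γ ^ (N - m) * ((N.choose m : ℕ) : MvPolynomial (Fin n) k) else 0 := by
    intro m _
    rw [show (Polynomial.C A * Polynomial.X) ^ m * Polynomial.C Γ ^ (N - m) * ((N.choose m : ℕ) : Polynomial (MvPolynomial (Fin n) k)) =
        Polynomial.C (A ^ m * Γ ^ (N - m) * ((N.choose m : ℕ) : MvPolynomial (Fin n) k)) * Polynomial.X ^ m by
      rw [mul_pow, ← map_pow, ← map_pow, ← map_natCast Polynomial.C, map_mul, map_mul]; ring]
    exact Polynomial.coeff_C_mul_X_pow _ _ _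
  rw [Finset.sum_congr rfl hterm, Finset.sum_ite_eq, if_pos (Finset.mem_range.2 (Nat.lt_succ_of_le hj)), ← map_natCast (C : k →+* MvPolynomial (Fin n) k),
    mul_comm _ (C _), coeff_C_mul]

/-! ## §2 Unitriangularity: the `w₀`-terms do not reach a low target exponent -/

/-- **THE `w₀`-SHIFT IS INVISIBLE BELOW `A^{j+1}`**: if `A = y^a·u` and the target exponent `d` satisfies `d i < (j+1)·a i` at some letter, then
`coeff_d (A^j (w₀A − B)^m) = coeff_d (A^j (−B)^m)` — the difference is a multiple of `A^{j+1}`, hence of `y^{(j+1)a}`. [OURS · the reason the exit tags hold at every point of the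
fibre line] -/
theorem coeff_mul_pow_shift_eq (a : Fin n →₀ ℕ) (u B : MvPolynomial (Fin n) k) (w₀ : k) (j m : ℕ) (d : Fin n →₀ ℕ) (hd : ∃ i, d i < (j + 1) * a i) :
    coeff d ((monomial a (1 : k) * u) ^ j * (C w₀ * (monomial a (1 : k) * u) - B) ^ m) = coeff d ((monomial a (1 : k) * u) ^ j * (-B) ^ m) := by
  set A : MvPolynomial (Fin n) k := monomial a (1 : k) * u with hA
  obtain ⟨q, hq⟩ := sub_dvd_pow_sub_pow (C w₀ * A - B) (-B) m
  have h1 : C w₀ * A - B - -B = C w₀ * A := by ring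
  rw [h1] at hq
  have h2 : A ^ j * (C w₀ * A - B) ^ m = A ^ j * (-B) ^ m + monomial ((j + 1) • a) (1 : k) * (C w₀ * u ^ (j + 1) * q) := by
    have h3 : (C w₀ * A - B) ^ m = (-B) ^ m + C w₀ * A * q := by rw [← hq]; ring
    have h4 : A ^ (j + 1) = monomial ((j + 1) • a) (1 : k) * u ^ (j + 1) := by rw [hA, mul_pow, monomial_pow, one_pow]
    rw [h3, mul_add, show A ^ j * (C w₀ * A * q) = C w₀ * A ^ (j + 1) * q by ring, h4]; ring
  rw [h2, coeff_add, coeff_monomial_mul', if_neg, add_zero]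
  obtain ⟨i, hi⟩ := hd
  intro hle
  have := hle i
  rw [Finsupp.smul_apply, smul_eq_mul] at this
  omega

/-! ## §3 Binomial coefficients below `p` -/

/-- `C(N, j) ≠ 0` in characteristic `p` when `j ≤ N < p`. [folklore: `p ∤ N!`] -/
theorem cast_choose_ne_zero (p : ℕ) [Fact p.Prime] [CharP k p] (N j : ℕ) (hN : N < p) (hj : j ≤ N) : ((N.choose j : ℕ) : k) ≠ 0 := by
  rw [Ne, CharP.cast_eq_zero_iff k p]
  intro h
  have hfac := Nat.choose_mul_factorial_mul_factorial hj
  have hdvd : p ∣ N.factorial := by rw [← hfac]; exact (h.mul_right _).mul_right _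
  exact absurd (((Fact.out : p.Prime).dvd_factorial).1 hdvd) (not_le.2 hN)

/-! ## §4 The two coefficient computations -/

/-- **PENCIL TARGET**: `coeff_{j·a + m·b} ((y^a u_A)^j (−(y^b u_B))^m) = (−1)^m (u_A(0))^j (u_B(0))^m` — constant terms are multiplicative. [plumbing] -/
theorem coeff_pencil_target (a b : Fin n →₀ ℕ) (uA uB : MvPolynomial (Fin n) k) (j m : ℕ) :
    coeff (j • a + m • b) ((monomial a (1 : k) * uA) ^ j * (-(monomial b (1 : k) * uB)) ^ m) = (-1) ^ m * constantCoeff uA ^ j * constantCoeff uB ^ m := by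
  have h : (monomial a (1 : k) * uA) ^ j * (-(monomial b (1 : k) * uB)) ^ m = monomial (j • a + m • b) ((-1 : k) ^ m) * (uA ^ j * uB ^ m) := by
    rw [neg_pow, mul_pow, mul_pow, monomial_pow, monomial_pow, one_pow, one_pow,
      show ((-1 : MvPolynomial (Fin n) k) ^ m) = C ((-1 : k) ^ m) by rw [map_pow, map_neg, map_one]]
    calc monomial (j • a) (1 : k) * uA ^ j * (C ((-1 : k) ^ m) * (monomial (m • b) (1 : k) * uB ^ m))
        = C ((-1 : k) ^ m) * (monomial (j • a) (1 : k) * monomial (m • b) 1) * (uA ^ j * uB ^ m) := by ring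
      _ = monomial (j • a + m • b) ((-1 : k) ^ m) * (uA ^ j * uB ^ m) := by rw [monomial_mul, one_mul, C_mul_monomial, mul_one]
  rw [h, coeff_monomial_mul', if_pos le_rfl, tsub_self, ← constantCoeff_eq, map_mul, map_pow, map_pow, mul_assoc]

/-- **DEEP TARGET**: `coeff_{m·D₁} ((u·y^{D₁} + v·y^{D₂})^m) = u^m` for `D₁ ≠ D₂` — every other term of the binomial expansion has a different exponent. [plumbing] -/
theorem coeff_binomial_pow (D₁ D₂ : Fin n →₀ ℕ) (hne : D₁ ≠ D₂) (u v : k) (m : ℕ) :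
    coeff (m • D₁) ((C u * monomial D₁ (1 : k) + C v * monomial D₂ (1 : k)) ^ m) = u ^ m := by
  have hterm : ∀ l, (C u * monomial D₁ (1 : k)) ^ l * (C v * monomial D₂ (1 : k)) ^ (m - l) * ((m.choose l : ℕ) : MvPolynomial (Fin n) k) =
      monomial (l • D₁ + (m - l) • D₂) (u ^ l * v ^ (m - l) * ((m.choose l : ℕ) : k)) := by
    intro l
    rw [mul_pow, mul_pow, monomial_pow, monomial_pow, one_pow, one_pow, ← C_pow, ← C_pow, C_mul_monomial, C_mul_monomial, mul_one, mul_one, monomial_mul,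
      ← map_natCast (C : k →+* MvPolynomial (Fin n) k), mul_comm (monomial _ _) (C _), C_mul_monomial]
    congr 1; ring
  rw [add_pow, coeff_sum, Finset.sum_eq_single m]
  · rw [hterm, coeff_monomial, tsub_self, zero_smul, add_zero, if_pos rfl, pow_zero, mul_one, Nat.choose_self, Nat.cast_one, mul_one]
  · intro l hl hlm
    rw [hterm, coeff_monomial, if_neg]
    intro heq
    have hl' : l < m := lt_of_le_of_ne (Nat.le_of_lt_succ (Finset.mem_range.1 hl)) hlm
    apply hne
    ext i
    have h1 := DFunLike.congr_fun heq i
    simp only [Finsupp.add_apply, Finsupp.smul_apply, smul_eq_mul] at h1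
    have h2 : (m - l) * D₂ i = (m - l) * D₁ i := by
      have : m * D₁ i = l * D₁ i + (m - l) * D₁ i := by rw [← Nat.add_mul]; congr 1; omega
      omega
    exact (Nat.eq_of_mul_eq_mul_left (by omega) h2).symm
  · intro h; exact absurd (Finset.mem_range.2 (Nat.lt_succ_self m)) h

/-- **DEEP TARGET behind a monomial and a scalar**: `coeff_{j·a + m·(b + D₁)} ((α·y^a)^j (−(y^b (u y^{D₁} + v y^{D₂})))^m) = (−1)^m α^j u^m` (`D₁ ≠ D₂`). [plumbing] -/
theorem coeff_deep_target (a b D₁ D₂ : Fin n →₀ ℕ) (hne : D₁ ≠ D₂) (α u v : k) (j m : ℕ) :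
    coeff (j • a + m • (b + D₁)) ((C α * monomial a (1 : k)) ^ j * (-(monomial b (1 : k) * (C u * monomial D₁ (1 : k) + C v * monomial D₂ (1 : k)))) ^ m) =
      (-1) ^ m * α ^ j * u ^ m := by
  have h : (C α * monomial a (1 : k)) ^ j * (-(monomial b (1 : k) * (C u * monomial D₁ (1 : k) + C v * monomial D₂ (1 : k)))) ^ m =
      monomial (j • a + m • b) ((-1 : k) ^ m * α ^ j) * (C u * monomial D₁ (1 : k) + C v * monomial D₂ (1 : k)) ^ m := by
    rw [neg_pow, mul_pow, mul_pow, monomial_pow, monomial_pow, one_pow, one_pow, ← C_pow,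
      show ((-1 : MvPolynomial (Fin n) k) ^ m) = C ((-1 : k) ^ m) by rw [map_pow, map_neg, map_one]]
    calc C (α ^ j) * monomial (j • a) (1 : k) * (C ((-1 : k) ^ m) * (monomial (m • b) (1 : k) * (C u * monomial D₁ 1 + C v * monomial D₂ 1) ^ m))
        = C ((-1 : k) ^ m) * C (α ^ j) * (monomial (j • a) (1 : k) * monomial (m • b) 1) * (C u * monomial D₁ 1 + C v * monomial D₂ 1) ^ m := by ring
      _ = monomial (j • a + m • b) ((-1 : k) ^ m * α ^ j) * (C u * monomial D₁ 1 + C v * monomial D₂ 1) ^ m := by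
          rw [monomial_mul, one_mul, ← map_mul, C_mul_monomial, mul_one]
  rw [h, smul_add, ← add_assoc, coeff_monomial_mul', if_pos le_self_add, add_tsub_cancel_left, coeff_binomial_pow k D₁ D₂ hne u v m, mul_assoc]

/-! ## §5 ★★ The substitution wrappers -/

set_option maxHeartbeats 800000 in
-- polynomial bookkeeping of the substitution on the generators
/-- ★★ **FULL OF A PENCIL CHART AT A CLOSED POINT FROM ONE COEFFICIENT.** `Φ = A⁺·X 0 − B⁺` prime; closed point `(w₀; c)` with `𝔪 ∩ k[W, y] = (X 0 − w₀, y_i − c_i)`; a substitution `v`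
with `v i = c_i` (letter killed to its value) or `v i = y_i + c_i` for `i ∈ T₀` (letter kept); if for some `j < p` and some exponent `d` with `d|_{T₀} < p` the coefficient
`coeff_d ((θᵥA)^j (w₀·θᵥA − θᵥB)^{p−1−j})` is non-zero, then `𝒪_{V(Φ),(w₀;c)}` is `FullCl p`. (§1 + §3 + ✓p695452.) [OURS · TASK 4b soundness engine; cite: Fedder1983, Thm. 1.12] -/
theorem fullCl_linearChart_of_subst (p : ℕ) [Fact p.Prime] [CharP k p] (A B : MvPolynomial (Fin n) k)
    (Φ : MvPolynomial (Fin (n + 1)) k) (hΦ : Φ = rename Fin.succ A * X 0 - rename Fin.succ B) (hΦp : Prime Φ)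
    (c : Fin n → k) (w₀ : k) (y : Spec (.of (MvPolynomial (Fin (n + 1)) k ⧸ Ideal.span {Φ}))) (hy : y.asIdeal.IsMaximal)
    (ha : y.asIdeal.comap (Ideal.Quotient.mk (Ideal.span {Φ})) =
      Ideal.span (Set.range (Fin.cons ((X 0 : MvPolynomial (Fin (n + 1)) k) - C w₀) fun i : Fin n => X i.succ - C (c i))))
    (v : Fin n → MvPolynomial (Fin n) k) (T₀ : Set (Fin n)) (hv : ∀ i, v i = C (c i) ∨ (i ∈ T₀ ∧ v i = X i + C (c i)))
    (j : ℕ) (hj : j < p) (d : Fin n →₀ ℕ) (hd : ∀ i ∈ T₀, d i < p)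
    (hcoeff : coeff d (aeval v A ^ j * (C w₀ * aeval v A - aeval v B) ^ (p - 1 - j)) ≠ 0) :
    FullCl p ((Spec (.of (MvPolynomial (Fin (n + 1)) k ⧸ Ideal.span {Φ}))).presheaf.stalk y) := by
  classical
  have hp1 : 1 ≤ p := (Fact.out : p.Prime).one_lt.le
  set θ : MvPolynomial (Fin (n + 1)) k →ₐ[k] MvPolynomial (Fin (n + 1)) k :=
    aeval (Fin.cons (X 0 + C w₀) fun i : Fin n => rename Fin.succ (v i)) with hθ
  have hθX0 : θ (X 0) = X 0 + C w₀ := by rw [hθ, aeval_X, Fin.cons_zero]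
  have hθsucc : ∀ q : MvPolynomial (Fin n) k, θ (rename Fin.succ q) = rename Fin.succ (aeval v q) := by
    intro q
    rw [hθ, aeval_rename, show rename Fin.succ (aeval v q) = ((rename Fin.succ).comp (aeval v)) q from rfl]
    congr 1
    refine MvPolynomial.algHom_ext fun i => ?_
    rw [AlgHom.comp_apply, aeval_X, aeval_X, Function.comp_apply, Fin.cons_succ]
  have hθΦ : θ Φ = rename Fin.succ (aeval v A) * X 0 + rename Fin.succ (C w₀ * aeval v A - aeval v B) := by
    rw [hΦ, map_sub, map_mul, hθsucc, hθsucc, hθX0, map_sub, map_mul, rename_C]; ring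
  have hjle : j ≤ p - 1 := by omega
  have hcoeffW : coeff (Finsupp.cons j d) (θ Φ ^ (p - 1)) = (((p - 1).choose j : ℕ) : k) * coeff d (aeval v A ^ j * (C w₀ * aeval v A - aeval v B) ^ (p - 1 - j)) := by
    rw [hθΦ, coeff_cons_linear_pow k _ _ (p - 1) j hjle d]
  have hsupp : Finsupp.cons j d ∈ ((θ : MvPolynomial (Fin (n + 1)) k →+* MvPolynomial (Fin (n + 1)) k) Φ ^ (p - 1)).support := by
    rw [mem_support_iff, RingHom.coe_coe, hcoeffW]
    exact mul_ne_zero (cast_choose_ne_zero k p (p - 1) j (by omega) hjle) hcoeff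
  refine PencilExitSoundnessKit.hypersurface_fullCl_stalk_of_reduction k p Φ hΦp _ y hy ha (θ : MvPolynomial (Fin (n + 1)) k →+* MvPolynomial (Fin (n + 1)) k)
    ({0} ∪ Set.range fun i : T₀ => (i.1.succ : Fin (n + 1))) (fun l => ?_) _ hsupp (fun l hl => ?_)
  · refine Fin.cases ?_ (fun i => ?_) l
    · right
      refine ⟨0, Set.mem_union_left _ rfl, ?_⟩
      rw [Fin.cons_zero, RingHom.coe_coe, map_sub, hθX0, hθ, aeval_C, algebraMap_eq]; ring
    · have hθi : θ (X i.succ) = rename Fin.succ (v i) := by rw [hθ, aeval_X, Fin.cons_succ]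
      rcases hv i with hvi | ⟨hiT, hvi⟩
      · left
        rw [Fin.cons_succ, RingHom.coe_coe, map_sub, hθi, hvi, rename_C, hθ, aeval_C, algebraMap_eq, sub_self]
      · right
        refine ⟨i.succ, Set.mem_union_right _ ⟨⟨i, hiT⟩, rfl⟩, ?_⟩
        rw [Fin.cons_succ, RingHom.coe_coe, map_sub, hθi, hvi, map_add, rename_X, rename_C, hθ, aeval_C, algebraMap_eq]; ring
  · rcases hl with hl | ⟨⟨i, hiT⟩, rfl⟩
    · rw [Set.mem_singleton_iff] at hl; subst hl
      rw [Finsupp.cons_zero]; exact hj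
    · rw [Finsupp.cons_succ]; exact hd i hiT

/-- ★★ **THE POLE VERSION** (`w₀ = 0`, generator `X 0` itself, no shift): FULL at `(0; c)` from one non-zero coefficient `coeff_d ((θᵥA)^j (−θᵥB)^{p−1−j})`. Used for the `U`-chart
`Φ_U = (y^{M₂}(y^r − y^s))⁺·U − (y^{M₁})⁺` at the pole `U = 0` of the fibre line (`A ↔ B` swapped). [OURS · TASK 4b soundness engine; cite: Fedder1983, Thm. 1.12] -/
theorem fullCl_linearChart_pole_of_subst (p : ℕ) [Fact p.Prime] [CharP k p] (A B : MvPolynomial (Fin n) k)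
    (Φ : MvPolynomial (Fin (n + 1)) k) (hΦ : Φ = rename Fin.succ A * X 0 - rename Fin.succ B) (hΦp : Prime Φ)
    (c : Fin n → k) (y : Spec (.of (MvPolynomial (Fin (n + 1)) k ⧸ Ideal.span {Φ}))) (hy : y.asIdeal.IsMaximal)
    (ha : y.asIdeal.comap (Ideal.Quotient.mk (Ideal.span {Φ})) =
      Ideal.span (Set.range (Fin.cons (X 0 : MvPolynomial (Fin (n + 1)) k) fun i : Fin n => X i.succ - C (c i))))
    (v : Fin n → MvPolynomial (Fin n) k) (T₀ : Set (Fin n)) (hv : ∀ i, v i = C (c i) ∨ (i ∈ T₀ ∧ v i = X i + C (c i)))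
    (j : ℕ) (hj : j < p) (d : Fin n →₀ ℕ) (hd : ∀ i ∈ T₀, d i < p)
    (hcoeff : coeff d (aeval v A ^ j * (-aeval v B) ^ (p - 1 - j)) ≠ 0) :
    FullCl p ((Spec (.of (MvPolynomial (Fin (n + 1)) k ⧸ Ideal.span {Φ}))).presheaf.stalk y) := by
  refine fullCl_linearChart_of_subst k p A B Φ hΦ hΦp c 0 y hy (by rw [ha, map_zero, sub_zero]) v T₀ hv j hj d hd ?_
  rwa [map_zero, zero_mul, zero_sub]

end Summit.ResolutionOfSingularities.ResolutionOfSingularities.Theorems.FInjectiveMacaulayfication.PencilExitWitness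

end
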